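import Summits.KontsevichZagierPeriods.KontsevichZagierPeriods.Theses.HurwitzMicroSectors
import Summits.KontsevichZagierPeriods.KontsevichZagierPeriods.Theorems.HurwitzMicroSectorsNormalFormPrinciplePiBoxTransfer
import Summits.KontsevichZagierPeriods.KontsevichZagierPeriods.Theorems.HurwitzMicroSectorsNormalFormPrincipleVariants2239

/-! TTRL-lite variant V2217 of stmt-KontsevichZagierPeriods-3869

Variant V2217 = `stub_boxRigidity` (the leaf `BoxRigidity` of `NormalFormPrinciple`: two representations
on open unit boxes with integrands of KZ's rational shape `p/q`, `p, q ∈ ℚ[x]`, and equal values are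
KZ-equivalent) under the JOINT bound `bound_nat:m≤2; bound_nat:m'≤4`. Verdict of the attempt seat:
**open** — this file is the exact-strength certificate, not a proof of the variant. With
`BoxVanishing K` := "every box-rational representation of dimension `K` and value `0` is a relation":
* a joint bound `m ≤ j, m' ≤ k` is ONE dimension, `max j k` (`boxRigidityLe_iff_boxVanishing`, file
  `…Variants2239`: pad both representations by unit intervals to the common box and subtract there —
  the difference has value `0` by soundness — one way; compare with the zero representation on the
  `0`-box the other way), so `V2217 ⟺ BoxVanishing 4` (`stub_boxRigidity_var2217_iff_boxVanishing_four`);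
* hence the bound `m ≤ 2` is idle next to `m' ≤ 4`: `V2217 ⟺ BoxRigidity for all m, m' ≤ 4`
  (`stub_boxRigidity_var2217_iff_le_four`) `⟺` the mirrored move `m ≤ 4, m' ≤ 2`
  (`stub_boxRigidity_var2217_iff_mirror`) `⟺` the sibling V2216 (`m = 2, m' ≤ 4`,
  `stub_boxRigidity_var2217_iff_var2216`) — the siblings of maximum dimension `4` all coincide;
* `V2217 ⇒ BoxVanishing j` for every `j ≤ 4` (`boxVanishing_le_four_of_stub_boxRigidity_var2217`): already
  its dimension-`2` layer says that EVERY vanishing `ℚ`-combination of absolutely convergent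
  `∫∫_{(0,1)²} p/q` (`π²`, `π log 2`, `log² 2`, Catalan's `G = ∫∫ dx dy/(1+x²y²)`, `Li₂` and Clausen
  values, `L(2,χ₋₃)`, …) is generated by the four moves — e.g. "`G = r ∈ ℚ` ⇒ `[(0,1)², 1/(1+x²y²)] ∼ [r]`":
  a proof must either decide such open irrationality questions or produce the chains; the tree's
  proved frontier is dimension `1` (`boxRigidity_of_le_one`, Baker), which is exactly the `m, m' ≤ 1`
  slice of V2217 (already landed verbatim as `stub_boxRigidity_var2229_slice_le_one`, file `…Variants2229`);
* conversely `KontsevichZagierPeriods ⇒ parent ⇒ V2217` (`stub_boxRigidity_var2217_of_statement`), so a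
  refutation of the variant would refute the Summit; `IntegralRep` carries `integrableOn` (no
  junk-value witness) and no invariant of the four moves beyond `eval` is known.
Residual goal (the variant CLOSED MODULO it: `stub_boxRigidity_var2217_of_boxVanishing_four`):
`∀ M : IntegralRep 4, M.domain = box → M.IsRational → M.value = 0 → of M ∈ relations`.
Source: M. Kontsevich, D. Zagier, *Periods* (2001), §1.2 Conjecture 1 and rules 1)–3).
Pure proof file, no definitions. -/

-- `Summit.<Summit>.<Problem>` is the tree's mandated summit-side namespace (CONVENTIONS §2); for this
-- single-conjunct summit the two coincide, so the duplicate is deliberate.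
set_option linter.dupNamespace false

noncomputable section

namespace Summit.KontsevichZagierPeriods.KontsevichZagierPeriods.Theorems

open MeasureTheory Set
open Literature.NumberTheory.Transcendental Literature.NumberTheory.Transcendental.KZ
open Summit.KontsevichZagierPeriods.KontsevichZagierPeriods.Theses.HurwitzMicroSectors
open Summit.KontsevichZagierPeriods.HurwitzMicroSectors.NormalFormPrinciple.PiBox

/-! ## The variant V2217: exactly `BoxVanishing 4` -/

/-- **V2217 ⟺ `BoxVanishing 4`**: the joint bound `m ≤ 2, m' ≤ 4` is the single dimension
`max 2 4 = 4` (`boxRigidityLe_iff_boxVanishing 2 4`). [cite: KontsevichZagier2001, §1.2 Conjecture 1] -/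
theorem stub_boxRigidity_var2217_iff_boxVanishing_four :
    (∀ (m m' : ℕ) (N : IntegralRep m) (N' : IntegralRep m'), m' ≤ 4 → m ≤ 2 → N.domain = {x | ∀ i, x i ∈ Set.Ioo (0:ℝ) 1} → N.IsRational → N'.domain = {x | ∀ i, x i ∈ Set.Ioo (0:ℝ) 1} → N'.IsRational → N.value = N'.value → Equivalent N N') ↔
    (∀ (M : IntegralRep 4), M.domain = {x | ∀ i, x i ∈ Set.Ioo (0:ℝ) 1} → M.IsRational →
      M.value = 0 → of M ∈ relations) :=
  boxRigidityLe_iff_boxVanishing 2 4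

/-- **V2217 under `BoxVanishing 4` as a hypothesis** (the variant CLOSED MODULO its residual goal,
stated verbatim): this is the exact missing input. [cite: KontsevichZagier2001, §1.2 Conjecture 1] -/
theorem stub_boxRigidity_var2217_of_boxVanishing_four
    (hvan : ∀ (M : IntegralRep 4), M.domain = {x | ∀ i, x i ∈ Set.Ioo (0:ℝ) 1} → M.IsRational →
      M.value = 0 → of M ∈ relations) :
    ∀ (m m' : ℕ) (N : IntegralRep m) (N' : IntegralRep m'), m' ≤ 4 → m ≤ 2 → N.domain = {x | ∀ i, x i ∈ Set.Ioo (0:ℝ) 1} → N.IsRational → N'.domain = {x | ∀ i, x i ∈ Set.Ioo (0:ℝ) 1} → N'.IsRational → N.value = N'.value → Equivalent N N' :=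
  stub_boxRigidity_var2217_iff_boxVanishing_four.2 hvan

/-- **The bound `m ≤ 2` is idle: V2217 ⟺ BoxRigidity for all `m, m' ≤ 4`** (both are
`BoxVanishing 4`). [cite: KontsevichZagier2001, §1.2 Conjecture 1] -/
theorem stub_boxRigidity_var2217_iff_le_four :
    (∀ (m m' : ℕ) (N : IntegralRep m) (N' : IntegralRep m'), m' ≤ 4 → m ≤ 2 → N.domain = {x | ∀ i, x i ∈ Set.Ioo (0:ℝ) 1} → N.IsRational → N'.domain = {x | ∀ i, x i ∈ Set.Ioo (0:ℝ) 1} → N'.IsRational → N.value = N'.value → Equivalent N N') ↔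
    (∀ (m m' : ℕ) (N : IntegralRep m) (N' : IntegralRep m'), m' ≤ 4 → m ≤ 4 →
      N.domain = {x | ∀ i, x i ∈ Set.Ioo (0:ℝ) 1} → N.IsRational →
      N'.domain = {x | ∀ i, x i ∈ Set.Ioo (0:ℝ) 1} → N'.IsRational →
      N.value = N'.value → Equivalent N N') :=
  stub_boxRigidity_var2217_iff_boxVanishing_four.trans (boxRigidityLe_iff_boxVanishing 4 4).symm

/-- **V2217 ⟺ the mirrored move `bound_nat:m≤4; bound_nat:m'≤2`** (both are `BoxVanishing 4`,
`max 4 2 = max 2 4`). [cite: KontsevichZagier2001, §1.2 Conjecture 1] -/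
theorem stub_boxRigidity_var2217_iff_mirror :
    (∀ (m m' : ℕ) (N : IntegralRep m) (N' : IntegralRep m'), m' ≤ 4 → m ≤ 2 → N.domain = {x | ∀ i, x i ∈ Set.Ioo (0:ℝ) 1} → N.IsRational → N'.domain = {x | ∀ i, x i ∈ Set.Ioo (0:ℝ) 1} → N'.IsRational → N.value = N'.value → Equivalent N N') ↔
    (∀ (m m' : ℕ) (N : IntegralRep m) (N' : IntegralRep m'), m' ≤ 2 → m ≤ 4 →
      N.domain = {x | ∀ i, x i ∈ Set.Ioo (0:ℝ) 1} → N.IsRational →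
      N'.domain = {x | ∀ i, x i ∈ Set.Ioo (0:ℝ) 1} → N'.IsRational →
      N.value = N'.value → Equivalent N N') :=
  stub_boxRigidity_var2217_iff_boxVanishing_four.trans (boxRigidityLe_iff_boxVanishing 4 2).symm

/-- **V2217 ⟺ the sibling V2216** (`fix_nat:m=2; bound_nat:m'≤4`): both are `BoxVanishing 4` — from
the V2216 shape compare a vanishing `4`-dimensional representation with the zero representation on the
`2`-box (itself a relation); conversely `boxRigidityLe_of_boxVanishing` at `K = 4` with `m = 2`. So the
two certificates are interchangeable, and V2217 ⟺ V2215 (`m = 2, m' = 4`) as well (file `…Variants2215`).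
[cite: KontsevichZagier2001, §1.2 Conjecture 1] -/
theorem stub_boxRigidity_var2217_iff_var2216 :
    (∀ (m m' : ℕ) (N : IntegralRep m) (N' : IntegralRep m'), m' ≤ 4 → m ≤ 2 → N.domain = {x | ∀ i, x i ∈ Set.Ioo (0:ℝ) 1} → N.IsRational → N'.domain = {x | ∀ i, x i ∈ Set.Ioo (0:ℝ) 1} → N'.IsRational → N.value = N'.value → Equivalent N N') ↔
    (∀ (m' : ℕ) (N : IntegralRep 2) (N' : IntegralRep m'), m' ≤ 4 → N.domain = {x | ∀ i, x i ∈ Set.Ioo (0:ℝ) 1} → N.IsRational → N'.domain = {x | ∀ i, x i ∈ Set.Ioo (0:ℝ) 1} → N'.IsRational → N.value = N'.value → Equivalent N N') := by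
  rw [stub_boxRigidity_var2217_iff_boxVanishing_four]
  refine ⟨fun hvan m' N N' hm' =>
      boxRigidityLe_of_boxVanishing (j := 2) (k := 4) (K := 4) (by norm_num) le_rfl hvan 2 m' N N' hm' le_rfl,
    fun h M hMd hMr hv => ?_⟩
  -- the zero representation on the `2`-box: box-rational, value `0`, itself a relation
  obtain ⟨Z, hZd, hZi⟩ := exists_zeroRep (isSemialgebraic_box 2)
  have hZ : of Z ∈ relations := of_mem_relations_of_eqOn_zero Z (by simp [hZi, EqOn])
  have hZv : Z.value = 0 := by simp [IntegralRep.value, hZi]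
  have hZr : Z.IsRational := ⟨0, 1, fun x _ => by simp, fun x _ => by simp [hZi]⟩
  have hZM : of Z - of M ∈ relations := h 4 Z M le_rfl hZd hZr hMd hMr (by rw [hv, hZv])
  have := relations.sub_mem hZ hZM
  rwa [sub_sub_cancel] at this

/-- **V2217 ⇒ `BoxVanishing` in every dimension `≤ 4`** (monotonicity along padding,
`boxVanishing_mono`), in particular the open dimension-`2` and dimension-`3` vanishing statements for
box-rational periods. [cite: KontsevichZagier2001, §1.2 Conjecture 1] -/
theorem boxVanishing_le_four_of_stub_boxRigidity_var2217
    (h : ∀ (m m' : ℕ) (N : IntegralRep m) (N' : IntegralRep m'), m' ≤ 4 → m ≤ 2 → N.domain = {x | ∀ i, x i ∈ Set.Ioo (0:ℝ) 1} → N.IsRational → N'.domain = {x | ∀ i, x i ∈ Set.Ioo (0:ℝ) 1} → N'.IsRational → N.value = N'.value → Equivalent N N')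
    {j : ℕ} (hj : j ≤ 4) (N : IntegralRep j) (hNd : N.domain = {x | ∀ i, x i ∈ Set.Ioo (0:ℝ) 1})
    (hNr : N.IsRational) (hv : N.value = 0) : of N ∈ relations :=
  boxVanishing_mono hj (stub_boxRigidity_var2217_iff_boxVanishing_four.1 h) N hNd hNr hv

/-- **The parent leaf ⇒ V2217** (specialisation; the converse is not claimed — the parent is
`BoxVanishing` in ALL dimensions, the variant only in dimension `4`). [cite: KontsevichZagier2001, §1.2 Conjecture 1] -/
theorem stub_boxRigidity_var2217_of_parent
    (h : ∀ (m m' : ℕ) (N : IntegralRep m) (N' : IntegralRep m'), N.domain = {x | ∀ i, x i ∈ Set.Ioo (0:ℝ) 1} → N.IsRational → N'.domain = {x | ∀ i, x i ∈ Set.Ioo (0:ℝ) 1} → N'.IsRational → N.value = N'.value → Equivalent N N') :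
    ∀ (m m' : ℕ) (N : IntegralRep m) (N' : IntegralRep m'), m' ≤ 4 → m ≤ 2 → N.domain = {x | ∀ i, x i ∈ Set.Ioo (0:ℝ) 1} → N.IsRational → N'.domain = {x | ∀ i, x i ∈ Set.Ioo (0:ℝ) 1} → N'.IsRational → N.value = N'.value → Equivalent N N' :=
  fun m m' N N' _ _ => h m m' N N'

/-- **`KontsevichZagierPeriods ⇒ V2217`**: the variant is a special case of Conjecture 1 for the tree's
calculus (`leaves_of_statement`) — so a refutation of the variant would refute the Summit.
[cite: KontsevichZagier2001, §1.2 Conjecture 1] -/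
theorem stub_boxRigidity_var2217_of_statement (h : _root_.KontsevichZagierPeriods) :
    ∀ (m m' : ℕ) (N : IntegralRep m) (N' : IntegralRep m'), m' ≤ 4 → m ≤ 2 → N.domain = {x | ∀ i, x i ∈ Set.Ioo (0:ℝ) 1} → N.IsRational → N'.domain = {x | ∀ i, x i ∈ Set.Ioo (0:ℝ) 1} → N'.IsRational → N.value = N'.value → Equivalent N N' :=
  stub_boxRigidity_var2217_of_parent (leaves_of_statement h).1

end Summit.KontsevichZagierPeriods.KontsevichZagierPeriods.Theorems

end
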